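import Mathlib
import HarnessLib
import Summits.NavierStokesRegularity.NavierStokesRegularity.Theorems.PoloidalWindowDoorPoloidalWindowRigidityUntwistedKinematics
import Summits.NavierStokesRegularity.NavierStokesRegularity.Theorems.PoloidalWindowDoorPoloidalWindowRigidityUntwistedSliceGlue
import Summits.NavierStokesRegularity.NavierStokesRegularity.Theorems.PoloidalWindowDoorLrcModEntireStreamSymmetryGerm

/-!
# Route `PoloidalWindowDoor`, crux `PoloidalWindowRigidity` (K2, stmt-NavierStokesRegularity-19708), skeleton `lrc-jet` v5,
# stub `stub_untwisted` — brick F5 (part 2, calculus half): ISOPARAMETRIC LEAVES + UNTWISTED ⇒ A ROTATION / TRANSLATION GERM ON A BOX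

Cell ns-regularity-ideate, seat ns-poloidal-K2-p3 (gen 6; `--supports stmt-NavierStokesRegularity-19708`, helper toward the registered
stub `stub_untwisted` of `Cruxes/PoloidalWindowRigidity/Lines/lrc_jet.lean` v5; paper proof = `Cruxes/PoloidalWindowRigidity/UNTWISTED-NOTE.md`
§3 "CONCLUSION", brick F5 of the K2 lead's `BRIEF-v5-bricks.md`; part 1 = `…UntwistedSliceGlue`, p548451).  This is the ENDGAME of
the untwisted theorem: the lead's separation files (`…UntwistedSeparation{,2}`, bricks F3a/F3b) end with «on an open set `U` of one
slice the vertical velocity `w = v₂(s,·)` is untwisted, `∂₂w = P(w,y₂)`, and has ISOPARAMETRIC LEAVES, `|∇ₕw|² = a(w,y₂)`,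
`Δₕw = b(w,y₂)`»; this file (pure calculus) and its sequel `…UntwistedIsoparametricClass` (class transfer) turn that into
`¬ IsBackwardSingularPoint v 0` (for 19708) and into the germ trichotomy of item stmt-20428 `LrcModEntire` (its untwisted halves):

* `exists_contDiff_eventuallyEq` — a `Cⁿ` germ of a function `ℝ → ℝ` at a point extends to a GLOBAL `Cⁿ` function (bump cutoff);
  `circles_or_lines_of_isoparametric_slice_local` — p548451's planar Levi-Civita–Segre dichotomy on a horizontal plane of `ℝ³` with the
  structure functions `a ∈ C²`, `b ∈ C¹` only required NEAR the base value `w(y₀)` (the Cramer quotients of the separation are not global).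
* `germ_of_leafwise` — **pure calculus.**  `w ∈ C³(ℝ³)`, `∂₂w = P(w,y₂)` on an open `U ∋ y₀` (`P ∈ C¹` at the leaf points),
  `|∇ₕw|² = a(w,y₂)`, `Δₕw = b(w,y₂)` on `U` (`a ∈ C²`, `b ∈ C¹` at the base leaf point), `∇ₕw(y₀) ≠ 0` ⇒ on a nonempty open `V ⊆ U`
  (where `∇ₕw ≠ 0`) EITHER `Dw(y)[J(y − c)] = 0` for one centre `c` (rotation germ about the FIXED vertical axis through `c`) OR
  `Dw(y)[e] = 0` for one horizontal `e ≠ 0` (translation germ).  Proof = UNTWISTED-NOTE §3 CONCLUSION: Segre on the plane `y₂ = (y₀)₂`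
  gives the germ ON THAT PLANE; `…UntwistedKinematics.horizontalPairing_eq_zero_of_slice` propagates it along the vertical lines of a
  ball (the pairing solves `φ̇ = P_wφ`).
* The CLASS TRANSFER (germ of `v₂(s,·)` ⇒ germ of the Clebsch stream function ⇒ germ of the vorticity ⇒ `¬ IsBackwardSingularPoint` /
  the `LrcModEntire` germ) is the sequel `…UntwistedIsoparametricClass` (file-size split).

WHAT THIS IS NOT: not a claim about Navier–Stokes regularity and not the stub `stub_untwisted` (whose remaining inputs are the lead's F2
normal form `(K1)+(V0)`, F4 = branch 2b, and the assembly) — the isoparametric endgame (bears_on LADDER-NS N0 via crux K2 = stmt-19708 and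
item stmt-20428).
-/

noncomputable section

-- the summit and its single sub-problem share the name (CONVENTIONS §1), as in every Theorems file
set_option linter.dupNamespace false

namespace Summit.NavierStokesRegularity.NavierStokesRegularity.Theorems.PoloidalWindowDoorPoloidalWindowRigidityUntwistedIsoparametric

open Set Function Filter Topology Metric
open scoped RealInnerProductSpace InnerProductSpace ContDiff
open Literature.Analysis Literature.Analysis.FluidPDE
open Summit.NavierStokesRegularity.NavierStokesRegularity.Theorems.PoloidalWindowDoorPoloidalWindowRigidityConstantShearMeans
open Summit.NavierStokesRegularity.NavierStokesRegularity.Theorems.PoloidalWindowDoorPoloidalWindowRigidityUntwistedSeparation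
open Summit.NavierStokesRegularity.NavierStokesRegularity.Theorems.PoloidalWindowDoorPoloidalWindowRigidityUntwistedKinematics
open Summit.NavierStokesRegularity.NavierStokesRegularity.Theorems.PoloidalWindowDoorPoloidalWindowRigidityUntwistedSliceGlue
open Summit.NavierStokesRegularity.NavierStokesRegularity.Theorems.PoloidalWindowDoorLrcModEntireStreamSymmetryGerm

/-! ### A `Cⁿ` germ on the line extends to a global `Cⁿ` function -/

/-- **Smooth cutoff extension.**  A function `g : ℝ → ℝ` of class `Cⁿ` at `q₀` (`n` finite) agrees near `q₀` with a GLOBALLY `Cⁿ` function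
(multiply by a smooth bump centred at `q₀` supported where `g` is `Cⁿ`). [folklore] -/
theorem exists_contDiff_eventuallyEq {n : ℕ} {g : ℝ → ℝ} {q₀ : ℝ} (hg : ContDiffAt ℝ n g q₀) :
    ∃ G : ℝ → ℝ, ContDiff ℝ n G ∧ G =ᶠ[𝓝 q₀] g := by
  have hev : ∀ᶠ q in 𝓝 q₀, ContDiffAt ℝ n g q := hg.eventually (by simp)
  obtain ⟨ε, hε, hball⟩ := Metric.eventually_nhds_iff_ball.1 hev
  let χ : ContDiffBump q₀ := ⟨ε / 4, ε / 2, by positivity, by linarith⟩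
  refine ⟨fun q => χ q * g q, ?_, ?_⟩
  · rw [contDiff_iff_contDiffAt]
    intro q
    by_cases hq : q ∈ ball q₀ ε
    · exact χ.contDiff.contDiffAt.mul (hball q hq)
    · have hlt : ε / 2 < dist q q₀ := by
        rw [mem_ball, not_lt] at hq
        linarith
      have hopen : IsOpen {q' : ℝ | ε / 2 < dist q' q₀} := isOpen_lt continuous_const (continuous_id.dist continuous_const)
      have hzero : (fun q' => χ q' * g q') =ᶠ[𝓝 q] fun _ => (0 : ℝ) := by
        filter_upwards [hopen.mem_nhds hlt] with q' hq'
        have h0 : χ q' = 0 := χ.zero_of_le_dist (le_of_lt hq')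
        simp [h0]
      exact contDiffAt_const.congr_of_eventuallyEq hzero
  · filter_upwards [Metric.ball_mem_nhds q₀ (by positivity : (0 : ℝ) < ε / 4)] with q hq
    have h1 : χ q = 1 := χ.one_of_mem_closedBall (Metric.ball_subset_closedBall hq)
    simp [h1]

/-! ### Levi-Civita–Segre on a horizontal plane, with LOCAL structure functions -/

/-- **Planar dichotomy on a horizontal plane of `ℝ³`, local structure functions.**  As
`…UntwistedSliceGlue.circles_or_lines_of_isoparametric_slice` (p548451), but `a ∈ C²` and `b ∈ C¹` are only required AT the base value
`f(ι_z x₀)` (hence near it): `U ⊆ ℝ³` open, `f ∈ C³(U)`, at the points of `U` of height `z`: `(∂₀f)² + (∂₁f)² = a(f)`, `∂₀∂₀f + ∂₁∂₁f = b(f)`,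
`a(f(ι_z x₀)) > 0` ⇒ on a nonempty open planar `V` with `ι_z(V) ⊆ U`, concentric CIRCLES (`∂ᵢf(ι_z x) = (b − a′/2)(f)·(xᵢ − cᵢ)`) or parallel
LINES (`∇ₕf(ι_z x) ∥ ∇ₕf(ι_z x₀) ≠ 0`).  (Extend the germs of `a, b` by `exists_contDiff_eventuallyEq`, shrink `U` to the preimage of the
agreement interval, apply p548451.) [folklore] -/
theorem circles_or_lines_of_isoparametric_slice_local {f : EuclideanSpace ℝ (Fin 3) → ℝ} {U : Set (EuclideanSpace ℝ (Fin 3))}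
    (hU : IsOpen U) (hf : ContDiffOn ℝ 3 f U) {a b : ℝ → ℝ} {z : ℝ} {x₀ : EuclideanSpace ℝ (Fin 2)}
    (hx₀ : (WithLp.toLp 2 ![x₀ 0, x₀ 1, z] : EuclideanSpace ℝ (Fin 3)) ∈ U)
    (ha : ContDiffAt ℝ 2 a (f (WithLp.toLp 2 ![x₀ 0, x₀ 1, z])))
    (hb : ContDiffAt ℝ 1 b (f (WithLp.toLp 2 ![x₀ 0, x₀ 1, z])))
    (h₁ : ∀ y ∈ U, y 2 = z →
      (fderiv ℝ f y (EuclideanSpace.single 0 1)) ^ 2 + (fderiv ℝ f y (EuclideanSpace.single 1 1)) ^ 2 = a (f y))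
    (h₂ : ∀ y ∈ U, y 2 = z →
      fderiv ℝ (fun y' => fderiv ℝ f y' (EuclideanSpace.single 0 1)) y (EuclideanSpace.single 0 1) +
        fderiv ℝ (fun y' => fderiv ℝ f y' (EuclideanSpace.single 1 1)) y (EuclideanSpace.single 1 1) = b (f y))
    (hpos : 0 < a (f (WithLp.toLp 2 ![x₀ 0, x₀ 1, z]))) :
    ∃ V : Set (EuclideanSpace ℝ (Fin 2)), IsOpen V ∧ V.Nonempty ∧
      (∀ x ∈ V, (WithLp.toLp 2 ![x 0, x 1, z] : EuclideanSpace ℝ (Fin 3)) ∈ U) ∧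
      ((∃ c : EuclideanSpace ℝ (Fin 2), ∀ x ∈ V,
          fderiv ℝ f (WithLp.toLp 2 ![x 0, x 1, z]) (EuclideanSpace.single 0 1) =
              (b (f (WithLp.toLp 2 ![x 0, x 1, z])) - deriv a (f (WithLp.toLp 2 ![x 0, x 1, z])) / 2) * (x 0 - c 0) ∧
            fderiv ℝ f (WithLp.toLp 2 ![x 0, x 1, z]) (EuclideanSpace.single 1 1) =
              (b (f (WithLp.toLp 2 ![x 0, x 1, z])) - deriv a (f (WithLp.toLp 2 ![x 0, x 1, z])) / 2) * (x 1 - c 1)) ∨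
       ((fderiv ℝ f (WithLp.toLp 2 ![x₀ 0, x₀ 1, z]) (EuclideanSpace.single 0 1) ≠ 0 ∨
            fderiv ℝ f (WithLp.toLp 2 ![x₀ 0, x₀ 1, z]) (EuclideanSpace.single 1 1) ≠ 0) ∧
          ∀ x ∈ V, fderiv ℝ f (WithLp.toLp 2 ![x 0, x 1, z]) (EuclideanSpace.single 0 1) *
                fderiv ℝ f (WithLp.toLp 2 ![x₀ 0, x₀ 1, z]) (EuclideanSpace.single 1 1) =
              fderiv ℝ f (WithLp.toLp 2 ![x 0, x 1, z]) (EuclideanSpace.single 1 1) *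
                fderiv ℝ f (WithLp.toLp 2 ![x₀ 0, x₀ 1, z]) (EuclideanSpace.single 0 1))) := by
  -- global extensions of the germs of `a` and `b`
  obtain ⟨A, hA, hAeq⟩ := exists_contDiff_eventuallyEq (n := 2) ha
  obtain ⟨B, hB, hBeq⟩ := exists_contDiff_eventuallyEq (n := 1) hb
  obtain ⟨N, hNsub, hNo, hNx⟩ := _root_.mem_nhds_iff.1 (hAeq.and hBeq)
  -- shrink `U` to the preimage of the agreement set `N`
  set U' : Set (EuclideanSpace ℝ (Fin 3)) := U ∩ f ⁻¹' N with hU'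
  have hU'o : IsOpen U' := hf.continuousOn.isOpen_inter_preimage hU hNo
  have hx₀' : (WithLp.toLp 2 ![x₀ 0, x₀ 1, z] : EuclideanSpace ℝ (Fin 3)) ∈ U' := ⟨hx₀, hNx⟩
  have hagree : ∀ y ∈ U', A (f y) = a (f y) ∧ B (f y) = b (f y) := fun y hy => hNsub hy.2
  have hderiv : ∀ y ∈ U', deriv A (f y) = deriv a (f y) := fun y hy => by
    have h : A =ᶠ[𝓝 (f y)] a := eventually_of_mem (hNo.mem_nhds hy.2) fun q hq => (hNsub hq).1
    exact h.deriv_eq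
  have h₁' : ∀ y ∈ U', y 2 = z →
      (fderiv ℝ f y (EuclideanSpace.single 0 1)) ^ 2 + (fderiv ℝ f y (EuclideanSpace.single 1 1)) ^ 2 = A (f y) :=
    fun y hy hz => by rw [(hagree y hy).1]; exact h₁ y hy.1 hz
  have h₂' : ∀ y ∈ U', y 2 = z →
      fderiv ℝ (fun y' => fderiv ℝ f y' (EuclideanSpace.single 0 1)) y (EuclideanSpace.single 0 1) +
        fderiv ℝ (fun y' => fderiv ℝ f y' (EuclideanSpace.single 1 1)) y (EuclideanSpace.single 1 1) = B (f y) :=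
    fun y hy hz => by rw [(hagree y hy).2]; exact h₂ y hy.1 hz
  have hpos' : 0 < A (f (WithLp.toLp 2 ![x₀ 0, x₀ 1, z])) := by rw [(hagree _ hx₀').1]; exact hpos
  obtain ⟨V, hVo, hVne, hVU', hcase⟩ :=
    circles_or_lines_of_isoparametric_slice hU'o (hf.mono inter_subset_left) hA hB hx₀' h₁' h₂' hpos'
  refine ⟨V, hVo, hVne, fun x hx => (hVU' x hx).1, ?_⟩
  rcases hcase with ⟨c, hc⟩ | hlines
  · left
    refine ⟨c, fun x hx => ?_⟩
    have h := hc x hx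
    rw [(hagree _ (hVU' x hx)).2, hderiv _ (hVU' x hx)] at h
    exact h
  · right
    exact hlines

/-! ### Coordinates: the horizontal projection `πₕ : ℝ³ → ℝ²` and the plane embeddings -/

/-- The horizontal projection `πₕ y = (y₀, y₁)` is a continuous linear map. [folklore] -/
theorem hproj_eq (y : EuclideanSpace ℝ (Fin 3)) :
    (WithLp.toLp 2 ![y 0, y 1] : EuclideanSpace ℝ (Fin 2)) =
      ((EuclideanSpace.proj (0 : Fin 3) : EuclideanSpace ℝ (Fin 3) →L[ℝ] ℝ).smulRight (EuclideanSpace.single (0 : Fin 2) (1 : ℝ)) +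
        (EuclideanSpace.proj (1 : Fin 3) : EuclideanSpace ℝ (Fin 3) →L[ℝ] ℝ).smulRight (EuclideanSpace.single (1 : Fin 2) (1 : ℝ))) y := by
  ext j
  fin_cases j <;> simp

/-- The horizontal projection is continuous. [folklore] -/
theorem continuous_hproj : Continuous fun y : EuclideanSpace ℝ (Fin 3) => (WithLp.toLp 2 ![y 0, y 1] : EuclideanSpace ℝ (Fin 2)) := by
  rw [show (fun y : EuclideanSpace ℝ (Fin 3) => (WithLp.toLp 2 ![y 0, y 1] : EuclideanSpace ℝ (Fin 2))) = _ from funext hproj_eq]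
  exact ContinuousLinearMap.continuous _

/-- The foot of the vertical segment: `y + (z − y₂)e₂ = ι_z(πₕ y)`. [folklore] -/
theorem verticalShift_eq_hplane (y : EuclideanSpace ℝ (Fin 3)) (z : ℝ) :
    y + (z - y 2) • (EuclideanSpace.single 2 (1 : ℝ) : EuclideanSpace ℝ (Fin 3)) = WithLp.toLp 2 ![y 0, y 1, z] := by
  ext j
  fin_cases j <;> simp

/-- `ι_{y₂}(πₕ y) = y`. [folklore] -/
theorem hplane_hproj_self (y : EuclideanSpace ℝ (Fin 3)) :
    (WithLp.toLp 2 ![y 0, y 1, y 2] : EuclideanSpace ℝ (Fin 3)) = y := by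
  ext j
  fin_cases j <;> rfl

/-- The rotation field splits along the horizontal basis: `J(y − c) = −(y₁ − c₁)e₀ + (y₀ − c₀)e₁`, so
`Dw(y)[J(y − c)] = −(y₁ − c₁)∂₀w(y) + (y₀ − c₀)∂₁w(y)`. [folklore] -/
theorem fderiv_rotGen_eq (w : EuclideanSpace ℝ (Fin 3) → ℝ) (y c : EuclideanSpace ℝ (Fin 3)) :
    fderiv ℝ w y (rotGen (y - c)) =
      -(y 1 - c 1) * fderiv ℝ w y (EuclideanSpace.single 0 (1 : ℝ)) + (y 0 - c 0) * fderiv ℝ w y (EuclideanSpace.single 1 (1 : ℝ)) := by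
  have hJ : rotGen (y - c) =
      (-(y 1 - c 1)) • (EuclideanSpace.single 0 (1 : ℝ) : EuclideanSpace ℝ (Fin 3)) +
        (y 0 - c 0) • (EuclideanSpace.single 1 (1 : ℝ) : EuclideanSpace ℝ (Fin 3)) := by
    ext i; fin_cases i <;> simp [rotGen]
  rw [hJ, map_add, map_smul, map_smul, smul_eq_mul, smul_eq_mul]

/-! ### Pure calculus: isoparametric leaves + untwisted ⇒ a rotation or translation germ on a box -/

/-- **ISOPARAMETRIC LEAVES OF AN UNTWISTED FUNCTION CARRY A 3-D SYMMETRY GERM** (UNTWISTED-NOTE §3, CONCLUSION).  Let `w ∈ C³(ℝ³)`,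
`U` open, `y₀ ∈ U` with `∇ₕw(y₀) ≠ 0`; suppose on `U`: `∂₂w = P(w,y₂)` (`P` of class `C¹` at the leaf points — UNTWISTED),
`(∂₀w)² + (∂₁w)² = a(w,y₂)` and `∂₀∂₀w + ∂₁∂₁w = b(w,y₂)` (`a` of class `C²`, `b` of class `C¹` at the base leaf point `(w y₀, (y₀)₂)` —
ISOPARAMETRIC LEAVES).  Then there is a nonempty open `V ⊆ U` on which `∇ₕw ≠ 0` and EITHER, for one point `c`,
`Dw(y)[J(y − c)] = 0` for all `y ∈ V` (the level sets of `w` are invariant under the rotations about the vertical axis through `c`),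
OR, for one horizontal vector `e ≠ 0`, `Dw(y)[e] = 0` for all `y ∈ V`.  Proof: Levi-Civita–Segre on the plane `y₂ = (y₀)₂` inside a
ball `B ⊆ U` (`circles_or_lines_of_isoparametric_slice_local`), then vertical propagation of the pairing `Dw[J(yₕ − c)]`, resp. `Dw[Jn₀]`,
along the vertical segments of `B` (`horizontalPairing_eq_zero_of_slice`). [folklore] -/
theorem germ_of_leafwise {w : EuclideanSpace ℝ (Fin 3) → ℝ} {P a b : ℝ × ℝ → ℝ} {U : Set (EuclideanSpace ℝ (Fin 3))}
    (hU : IsOpen U) (hw : ContDiff ℝ 3 w)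
    (hPd : ∀ y ∈ U, ContDiffAt ℝ 1 P (w y, y 2))
    (hP : ∀ y ∈ U, fderiv ℝ w y (EuclideanSpace.single 2 (1 : ℝ)) = P (w y, y 2))
    {y₀ : EuclideanSpace ℝ (Fin 3)} (hy₀ : y₀ ∈ U)
    (ha : ContDiffAt ℝ 2 a (w y₀, y₀ 2)) (hb : ContDiffAt ℝ 1 b (w y₀, y₀ 2))
    (hE : ∀ y ∈ U, fderiv ℝ w y (EuclideanSpace.single 0 (1 : ℝ)) ^ 2 + fderiv ℝ w y (EuclideanSpace.single 1 (1 : ℝ)) ^ 2 = a (w y, y 2))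
    (hM : ∀ y ∈ U, fderiv ℝ (fun y' => fderiv ℝ w y' (EuclideanSpace.single 0 (1 : ℝ))) y (EuclideanSpace.single 0 (1 : ℝ)) +
      fderiv ℝ (fun y' => fderiv ℝ w y' (EuclideanSpace.single 1 (1 : ℝ))) y (EuclideanSpace.single 1 (1 : ℝ)) = b (w y, y 2))
    (hnd : fderiv ℝ w y₀ (EuclideanSpace.single 0 (1 : ℝ)) ≠ 0 ∨ fderiv ℝ w y₀ (EuclideanSpace.single 1 (1 : ℝ)) ≠ 0) :
    ∃ V : Set (EuclideanSpace ℝ (Fin 3)), IsOpen V ∧ V.Nonempty ∧ V ⊆ U ∧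
      (∀ y ∈ V, fderiv ℝ w y (EuclideanSpace.single 0 (1 : ℝ)) ≠ 0 ∨ fderiv ℝ w y (EuclideanSpace.single 1 (1 : ℝ)) ≠ 0) ∧
      ((∃ c : EuclideanSpace ℝ (Fin 3), ∀ y ∈ V, fderiv ℝ w y (rotGen (y - c)) = 0) ∨
       (∃ e : EuclideanSpace ℝ (Fin 3), e ≠ 0 ∧ e 2 = 0 ∧ ∀ y ∈ V, fderiv ℝ w y e = 0)) := by
  have hw2 : ContDiff ℝ 2 w := hw.of_le (by norm_num)
  set e₀ : EuclideanSpace ℝ (Fin 3) := EuclideanSpace.single 0 (1 : ℝ) with he₀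
  set e₁ : EuclideanSpace ℝ (Fin 3) := EuclideanSpace.single 1 (1 : ℝ) with he₁
  set e₂ : EuclideanSpace ℝ (Fin 3) := EuclideanSpace.single 2 (1 : ℝ) with he₂
  -- the horizontal energy `E = |∇ₕw|²` is continuous and positive at `y₀`
  set Ef : EuclideanSpace ℝ (Fin 3) → ℝ := fun y => fderiv ℝ w y e₀ ^ 2 + fderiv ℝ w y e₁ ^ 2 with hEf
  have hEc : Continuous Ef := by
    have hc : ∀ v : EuclideanSpace ℝ (Fin 3), Continuous fun y => fderiv ℝ w y v := fun v =>
      (hw.continuous_fderiv (by norm_num)).clm_apply continuous_const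
    exact ((hc e₀).pow 2).add ((hc e₁).pow 2)
  have hE0 : 0 < Ef y₀ := by
    rcases hnd with h | h
    · have : 0 < fderiv ℝ w y₀ e₀ ^ 2 := by positivity
      have : 0 ≤ fderiv ℝ w y₀ e₁ ^ 2 := sq_nonneg _
      simp only [hEf]; linarith
    · have : 0 < fderiv ℝ w y₀ e₁ ^ 2 := by positivity
      have : 0 ≤ fderiv ℝ w y₀ e₀ ^ 2 := sq_nonneg _
      simp only [hEf]; linarith
  -- a ball `B ⊆ U` on which `E > 0`
  have hO : IsOpen (U ∩ Ef ⁻¹' Ioi 0) := hU.inter (isOpen_Ioi.preimage hEc)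
  obtain ⟨δ, hδ, hBall⟩ := Metric.isOpen_iff.1 hO y₀ ⟨hy₀, hE0⟩
  have hBU : ball y₀ δ ⊆ U := fun y hy => (hBall hy).1
  have hBnd : ∀ y ∈ ball y₀ δ, fderiv ℝ w y e₀ ≠ 0 ∨ fderiv ℝ w y e₁ ≠ 0 := by
    intro y hy
    have hpos : 0 < Ef y := (hBall hy).2
    by_contra h
    push Not at h
    simp only [hEf, h.1, h.2] at hpos
    norm_num at hpos
  -- Segre on the plane `y₂ = (y₀)₂` inside the ball
  set z₀ : ℝ := y₀ 2 with hz₀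
  set x₀ : EuclideanSpace ℝ (Fin 2) := WithLp.toLp 2 ![y₀ 0, y₀ 1] with hx₀
  have hιx₀ : (WithLp.toLp 2 ![x₀ 0, x₀ 1, z₀] : EuclideanSpace ℝ (Fin 3)) = y₀ := hplane_hproj_self y₀
  obtain ⟨V₂, hV₂o, hV₂ne, hV₂B, hcase⟩ := circles_or_lines_of_isoparametric_slice_local (f := w) (U := ball y₀ δ)
    (a := fun q => a (q, z₀)) (b := fun q => b (q, z₀)) (z := z₀) (x₀ := x₀) isOpen_ball hw.contDiffOn
    (by rw [hιx₀]; exact mem_ball_self hδ)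
    (by
      rw [hιx₀]
      have hf : ContDiffAt ℝ 2 (fun q : ℝ => (q, z₀)) (w y₀) := contDiffAt_id.prodMk contDiffAt_const
      exact ContDiffAt.comp (g := a) (f := fun q : ℝ => (q, z₀)) (w y₀) ha hf)
    (by
      rw [hιx₀]
      have hf : ContDiffAt ℝ 1 (fun q : ℝ => (q, z₀)) (w y₀) := contDiffAt_id.prodMk contDiffAt_const
      exact ContDiffAt.comp (g := b) (f := fun q : ℝ => (q, z₀)) (w y₀) hb hf)
    (fun y hy hyz => by rw [← hyz]; exact hE y (hBU hy))
    (fun y hy hyz => by rw [← hyz]; exact hM y (hBU hy))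
    (by rw [hιx₀]; simpa [hEf] using (hE y₀ hy₀) ▸ hE0)
  -- the vertical cylinder over `V₂` inside the ball
  set V : Set (EuclideanSpace ℝ (Fin 3)) := ball y₀ δ ∩ (fun y => (WithLp.toLp 2 ![y 0, y 1] : EuclideanSpace ℝ (Fin 2))) ⁻¹' V₂ with hV
  have hVo : IsOpen V := isOpen_ball.inter (hV₂o.preimage continuous_hproj)
  have hVne : V.Nonempty := by
    obtain ⟨x, hx⟩ := hV₂ne
    refine ⟨WithLp.toLp 2 ![x 0, x 1, z₀], hV₂B x hx, ?_⟩
    show (WithLp.toLp 2 ![(WithLp.toLp 2 ![x 0, x 1, z₀] : EuclideanSpace ℝ (Fin 3)) 0,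
      (WithLp.toLp 2 ![x 0, x 1, z₀] : EuclideanSpace ℝ (Fin 3)) 1] : EuclideanSpace ℝ (Fin 2)) ∈ V₂
    have e : (WithLp.toLp 2 ![(WithLp.toLp 2 ![x 0, x 1, z₀] : EuclideanSpace ℝ (Fin 3)) 0,
        (WithLp.toLp 2 ![x 0, x 1, z₀] : EuclideanSpace ℝ (Fin 3)) 1] : EuclideanSpace ℝ (Fin 2)) = x := by
      ext j; fin_cases j <;> rfl
    rw [e]; exact hx
  have hVB : V ⊆ ball y₀ δ := inter_subset_left
  -- vertical propagation inside the ball, from the foot `ι_{z₀}(πₕ y)` to `y`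
  have hprop : ∀ y ∈ V, ∀ α β : ℝ,
      α * fderiv ℝ w (WithLp.toLp 2 ![y 0, y 1, z₀]) e₀ + β * fderiv ℝ w (WithLp.toLp 2 ![y 0, y 1, z₀]) e₁ = 0 →
      α * fderiv ℝ w y e₀ + β * fderiv ℝ w y e₁ = 0 := by
    intro y hy α β h0
    have hseg : ∀ t ∈ uIcc z₀ (y 2), y + (t - y 2) • e₂ ∈ U := fun t ht =>
      hBU (lt_of_le_of_lt (dist_verticalShift_le ht) (mem_ball.1 (hVB hy)))
    refine horizontalPairing_eq_zero_of_slice hU hw2 hPd hP α β hseg ?_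
    rw [verticalShift_eq_hplane y z₀]
    exact h0
  refine ⟨V, hVo, hVne, hVB.trans hBU, fun y hy => hBnd y (hVB hy), ?_⟩
  rcases hcase with ⟨c₂, hc₂⟩ | ⟨hne, hpar⟩
  · -- CIRCLES about the vertical axis through `c = (c₂, 0)`
    left
    refine ⟨WithLp.toLp 2 ![c₂ 0, c₂ 1, 0], fun y hy => ?_⟩
    set x : EuclideanSpace ℝ (Fin 2) := WithLp.toLp 2 ![y 0, y 1] with hx
    have hxV : x ∈ V₂ := hy.2
    obtain ⟨h0, h1⟩ := hc₂ x hxV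
    have ex0 : x 0 = y 0 := rfl
    have ex1 : x 1 = y 1 := rfl
    rw [ex0, ex1] at h0 h1
    have hfoot : -(y 1 - c₂ 1) * fderiv ℝ w (WithLp.toLp 2 ![y 0, y 1, z₀]) e₀ +
        (y 0 - c₂ 0) * fderiv ℝ w (WithLp.toLp 2 ![y 0, y 1, z₀]) e₁ = 0 := by
      rw [he₀, he₁, h0, h1]
      ring
    have h := hprop y hy _ _ hfoot
    rw [fderiv_rotGen_eq]
    simpa using h
  · -- LINES with normal `n₀ = ∇ₕw(y₀)`: translation germ along `e = Jn₀`
    right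
    rw [hιx₀] at hne hpar
    set n0 : ℝ := fderiv ℝ w y₀ (EuclideanSpace.single 0 1) with hn0
    set n1 : ℝ := fderiv ℝ w y₀ (EuclideanSpace.single 1 1) with hn1
    refine ⟨(-n1) • e₀ + n0 • e₁, ?_, ?_, fun y hy => ?_⟩
    · intro h
      have h0 := congrArg (fun u : EuclideanSpace ℝ (Fin 3) => u 0) h
      have h1 := congrArg (fun u : EuclideanSpace ℝ (Fin 3) => u 1) h
      simp [he₀, he₁] at h0 h1
      rcases hne with h | h
      · exact h h1
      · exact h h0
    · simp [he₀, he₁]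
    · set x : EuclideanSpace ℝ (Fin 2) := WithLp.toLp 2 ![y 0, y 1] with hx
      have hxV : x ∈ V₂ := hy.2
      have h := hpar x hxV
      have ex0 : x 0 = y 0 := rfl
      have ex1 : x 1 = y 1 := rfl
      rw [ex0, ex1] at h
      have hfoot : (-n1) * fderiv ℝ w (WithLp.toLp 2 ![y 0, y 1, z₀]) e₀ + n0 * fderiv ℝ w (WithLp.toLp 2 ![y 0, y 1, z₀]) e₁ = 0 := by
        rw [he₀, he₁, hn0, hn1]
        linear_combination -h
      have h := hprop y hy _ _ hfoot
      rw [map_add, map_smul, map_smul, smul_eq_mul, smul_eq_mul]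
      exact h

end Summit.NavierStokesRegularity.NavierStokesRegularity.Theorems.PoloidalWindowDoorPoloidalWindowRigidityUntwistedIsoparametric

end
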